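import Summits.ResolutionOfSingularities.ResolutionOfSingularities.Theorems.FrobeniusLadderFRationalResolutionSegreChartRegular
import Literature.AlgebraicGeometry.Resolution.AffineBlowupResolutionCriterion
import HarnessLib

/-!
# Cone programme: RUNG 4′ ON ALL SEGRE CONES `C(ℙᵃ⁻¹ × ℙᵇ⁻¹)`, EVERY FIELD — one blow-up of the vertex

Support file for crux stmt-ResolutionOfSingularities-15317 (`FrobeniusLadder.FRationalResolution`), line `redirect`,
CONE PROGRAMME (rung 4′ = `Scheme.HasResolution` in all dimensions on the Veronese and Segre cones; composition for
the Segre family). For every field `k` and all `a, b ≥ 1` the affine cone `Spec SR[a,b]`, `SR[a,b] = k[xᵢyⱼ] ⊆ k[x,y]`,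
over the Segre embedding of `ℙᵃ⁻¹ × ℙᵇ⁻¹` (dimension `a + b − 1`; singular for `a, b ≥ 2`; not ℚ-Gorenstein for
`a ≠ b`; a direct summand of `k[x,y]`, `stub_segre_retract`, hence with all ideals tightly closed) HAS A RESOLUTION OF
SINGULARITIES: the blowing up `Bl_{SM} Spec SR[a,b] → Spec SR[a,b]` of the vertex ideal `SM = (xᵢyⱼ)`. By the tree's
one-blow-up criterion `hasResolution_Spec_of_isRegularRing_blowupAlgebra` (proper: `SM` finitely generated;
birational: `xᵢ₀yⱼ₀ ∈ SM` is a non-zero-divisor of the domain `SR[a,b]`; regular: the charts `D₊(xᵢyⱼ t)` of the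
generating family cover the blowing up and EVERY chart `SR[a,b][SM/xᵢyⱼ] ≅ 𝔸^{a+b-1}` is a regular ring —
`stub_segre_chart_isRegularRing`, p794413). [folklore; Kollár 2007 §2.2; Görtz–Wedhorn Prop. 13.91 (4)] -/

-- single-problem summit: the doubled namespace component is forced
set_option linter.dupNamespace false

noncomputable section

namespace Summit.ResolutionOfSingularities.ResolutionOfSingularities.Theorems.FRationalResolution

open MvPolynomial AlgebraicGeometry
open Literature.AlgebraicGeometry.Resolution

section Cones

variable (k : Type) [Field k]

/-- The polynomial ring in two blocks of `a` and `b` variables `xᵢ = X (inl i)`, `yⱼ = X (inr j)`. -/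
local notation3 "SP[" a ", " b "]" => MvPolynomial (Fin a ⊕ Fin b) k

/-- The Segre ring `k[xᵢyⱼ] ⊆ k[x, y]` (same term as in `…SegreChartRegular.lean`; the named arguments of
`MvPolynomial.X` only fix the elaboration order). -/
local notation3 "SR[" a ", " b "]" =>
  Algebra.adjoin k (Set.range (fun ij : Fin a × Fin b =>
    (MvPolynomial.X (R := k) (σ := Fin a ⊕ Fin b) (Sum.inl ij.1) *
      MvPolynomial.X (R := k) (σ := Fin a ⊕ Fin b) (Sum.inr ij.2) : MvPolynomial (Fin a ⊕ Fin b) k)))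

/-- The vertex ideal of the Segre cone: spanned by the generators `xᵢyⱼ`. -/
local notation3 "SM[" a ", " b "]" =>
  Ideal.span {v : ↥SR[a, b] | ∃ ij : Fin a × Fin b,
    (v : MvPolynomial (Fin a ⊕ Fin b) k) = MvPolynomial.X (Sum.inl ij.1) * MvPolynomial.X (Sum.inr ij.2)}

/-- The generator `xᵢyⱼ` as an element of the Segre ring `SR[a,b]`. -/
local notation3 "SG[" a ", " b ", " i ", " j "]" =>
  (⟨MvPolynomial.X (Sum.inl i) * MvPolynomial.X (Sum.inr j), segreChart_X_mul_X_mem k a b i j⟩ : ↥SR[a, b])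

/-- The generating set of the vertex ideal `SM[a,b]` is the range of the family `(i,j) ↦ xᵢyⱼ`. [folklore] -/
theorem segreCone_genSet_eq_range (a b : ℕ) :
    {v : ↥SR[a, b] | ∃ ij : Fin a × Fin b, (v : SP[a, b]) = X (Sum.inl ij.1) * X (Sum.inr ij.2)} =
      Set.range (fun ij : Fin a × Fin b => SG[a, b, ij.1, ij.2]) := by
  ext v
  constructor
  · rintro ⟨ij, hv⟩
    exact ⟨ij, Subtype.ext hv.symm⟩
  · rintro ⟨ij, rfl⟩
    exact ⟨ij, rfl⟩

/-- The generator `xᵢ₀yⱼ₀` is a non-zero-divisor of the domain `SR[a,b] ⊆ k[x,y]`. [folklore] -/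
theorem segreCone_gen_mem_nonZeroDivisors (a b : ℕ) (i₀ : Fin a) (j₀ : Fin b) :
    SG[a, b, i₀, j₀] ∈ nonZeroDivisors ↥SR[a, b] := by
  refine mem_nonZeroDivisors_of_ne_zero fun h => ?_
  have h' := congrArg Subtype.val h
  simp only [ZeroMemClass.coe_zero, mul_eq_zero, X_ne_zero, or_self] at h'

/-- **RUNG 4′ ON ALL SEGRE CONES, EVERY FIELD.** For every field `k` and all `a, b ≥ 1` (witnessed by `i₀ : Fin a`,
`j₀ : Fin b`) the affine cone `Spec k[xᵢyⱼ]` over the Segre embedding of `ℙᵃ⁻¹ × ℙᵇ⁻¹` has a resolution of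
singularities: the blowing up of the vertex ideal `SM = (xᵢyⱼ)`, by the one-blow-up criterion
`hasResolution_Spec_of_isRegularRing_blowupAlgebra` — `SM` is finitely generated, `xᵢ₀yⱼ₀ ∈ SM` is a
non-zero-divisor, and every chart `SR[a,b][SM/xᵢyⱼ]` is a regular ring (`stub_segre_chart_isRegularRing`).
[folklore; Kollár 2007 §2.2 (blow-up of a vertex); Görtz–Wedhorn Prop. 13.91 (4)] -/
theorem hasResolution_segreCone (a b : ℕ) (i₀ : Fin a) (j₀ : Fin b) :
    Scheme.HasResolution (Spec (CommRingCat.of ↥SR[a, b])) := by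
  have hset := segreCone_genSet_eq_range k a b
  have hI : SM[a, b] = Ideal.span (Set.range (fun ij : Fin a × Fin b => SG[a, b, ij.1, ij.2])) := by
    rw [hset]
  have hfg : (SM[a, b]).FG := by
    rw [hI]
    exact Submodule.fg_span (Set.finite_range _)
  exact hasResolution_Spec_of_isRegularRing_blowupAlgebra (I := SM[a, b]) hfg
    (fun ij : Fin a × Fin b => SG[a, b, ij.1, ij.2]) (fun ij => segreChart_gen_mem_SM k a b ij.1 ij.2) hI.le
    (segreChart_gen_mem_SM k a b i₀ j₀) (segreCone_gen_mem_nonZeroDivisors k a b i₀ j₀)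
    (fun ij => stub_segre_chart_isRegularRing k a b ij.1 ij.2 _ rfl)

end Cones

end Summit.ResolutionOfSingularities.ResolutionOfSingularities.Theorems.FRationalResolution

end
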